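import Mathlib
import Summits.ValiantsHypothesis.ValiantsHypothesis.Theorems.NewtonUnitEquationsNewtonTauWeakMedianSplitting

/-!
# Median splitting of exact-cover clouds (crux `NewtonTauWeak`, three-bin law task, EC)

Items `j : Fin N` with labels `g j : Fin r → ZMod 2` (support `{i | g j i = 1}`) and vectors `ε j : ℕ²`.  For
`W ⊆ Fin r`, a COVER OF `W` is a set `J` of items with nonempty supports inside `W` covering every point of `W` exactly
once; its point is `a + Σ_{j ∈ J} ε j` (offset `a`), and `cl W a` is the cloud of all such points.  MEDIAN DATUM of a
cover `J` of `V` (`|V| = n ≥ 1`, `k = ⌈n/2⌉`): order the blocks of `J` by item index and let `B` be the block at which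
the running union first reaches `k` points, `T` the union of the earlier blocks, `T' = T ⊔ B`.  Given `(T, T')` the
covers form the product (covers of `T`) × (items with support `T' \ T`) × (covers of `V \ T'`), all genuine covers of
`V`; so the chart points of `cl V a` number at most the sum over the `≤ 3^n` data of the chart-point counts of
`cl T a` and of the sumset (items with support `T' \ T`) ⊕ `cl (V \ T') 0` (`chart_ncard_le_sum_medianEC`).
Iterated (file `…ExactCoverBound`): every exact-cover cloud has `2^{O(r)}·O(N log r)` exposed points (base `9`).
-/

-- Sub = Summit single-conjunct layout: the duplicated namespace component is mandated by the tree.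
set_option linter.dupNamespace false

open scoped BigOperators

namespace Summit.ValiantsHypothesis.ValiantsHypothesis.Theorems.NewtonUnitEquationsNewtonTauWeak

namespace ExactCoverSplittingAux

variable {N r : ℕ} (g : Fin N → Fin r → ZMod 2)

section Cov

variable (cov : Finset (Fin r) → Finset (Fin N) → Prop)
  (hcov : ∀ W J, cov W J ↔ (∀ j ∈ J, (∃ i, g j i = 1) ∧ ∀ i, g j i = 1 → i ∈ W) ∧
    (∀ i ∈ W, ∃ j ∈ J, g j i = 1) ∧ ∀ i, ∀ j ∈ J, ∀ j' ∈ J, g j i = 1 → g j' i = 1 → j = j')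
include hcov

/-- THE COVERING MAP of a cover `J` of a nonempty `V`: a function `f` sending each point of `V` to the item of `J`
covering it (unique). [folklore] -/
theorem exists_coverMap {V : Finset (Fin r)} {J : Finset (Fin N)} (hJ : cov V J) (hV : V.Nonempty) :
    ∃ f : Fin r → Fin N, (∀ i ∈ V, f i ∈ J ∧ g (f i) i = 1) ∧ ∀ i ∈ V, ∀ j ∈ J, g j i = 1 → f i = j := by
  classical
  rw [hcov] at hJ
  obtain ⟨h1, h2, h3⟩ := hJ
  obtain ⟨i₀, hi₀⟩ := hV
  obtain ⟨j₀, hj₀, -⟩ := h2 i₀ hi₀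
  refine ⟨fun i => if h : ∃ j ∈ J, g j i = 1 then h.choose else j₀, fun i hi => ?_, fun i hi j hj hji => ?_⟩
  · have h : ∃ j ∈ J, g j i = 1 := h2 i hi
    simp only [h, ↓reduceDIte]
    exact h.choose_spec
  · have h : ∃ j ∈ J, g j i = 1 := ⟨j, hj, hji⟩
    simp only [h, ↓reduceDIte]
    exact h3 i _ h.choose_spec.1 j hj h.choose_spec.2 hji

/-- SPLITTING A COVER at its median datum: for a cover `J` of `V` and `1 ≤ k ≤ |V|` there are `T ⊆ T' ⊆ V` with
`|T| < k ≤ |T'|`, a median item `m ∈ J` with support `T' \ T`, and the sub-covers `J₁` of `T`, `J₂` of `V \ T'` with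
`Σ_J ε = Σ_{J₁} ε + ε m + Σ_{J₂} ε`. [folklore] -/
theorem exists_split (ε : Fin N → (Fin 2 →₀ ℕ)) {V : Finset (Fin r)} {J : Finset (Fin N)} (hJ : cov V J)
    {k : ℕ} (hk : 1 ≤ k) (hkV : k ≤ V.card) :
    ∃ (T T' : Finset (Fin r)) (m : Fin N) (J₁ J₂ : Finset (Fin N)), T ⊆ T' ∧ T' ⊆ V ∧ T.card < k ∧ k ≤ T'.card ∧
      (∀ i, g m i = 1 ↔ i ∈ T' ∧ i ∉ T) ∧ cov T J₁ ∧ cov (V \ T') J₂ ∧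
      ∑ j ∈ J, ε j = ∑ j ∈ J₁, ε j + ε m + ∑ j ∈ J₂, ε j := by
  classical
  have hV : V.Nonempty := Finset.card_pos.mp (lt_of_lt_of_le hk hkV)
  obtain ⟨f, hf, hfu⟩ := exists_coverMap g cov hcov hJ hV
  rw [hcov] at hJ
  obtain ⟨h1, h2, h3⟩ := hJ
  obtain ⟨m, ⟨u, huV, hum⟩, hTlt, hkT'⟩ := MedianSplittingAux.exists_median f V hk hkV
  have hmJ : m ∈ J := hum ▸ (hf u huV).1
  -- the support of an item of `J` lies where `f` takes the value `j`
  have hsupp : ∀ j ∈ J, ∀ i, g j i = 1 → i ∈ V ∧ f i = j := fun j hj i hji =>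
    ⟨(h1 j hj).2 i hji, hfu i ((h1 j hj).2 i hji) j hj hji⟩
  refine ⟨V.filter fun i => f i < m, V.filter fun i => f i ≤ m, m, J.filter fun j => j < m,
    J.filter fun j => m < j, fun i hi => ?_, Finset.filter_subset _ _, hTlt, hkT', fun i => ?_, ?_, ?_, ?_⟩
  · rw [Finset.mem_filter] at hi ⊢
    exact ⟨hi.1, le_of_lt hi.2⟩
  · -- support of the median item = `T' \ T`
    constructor
    · intro hmi
      obtain ⟨hiV, hfi⟩ := hsupp m hmJ i hmi
      simp only [Finset.mem_filter, hiV, hfi, le_refl, and_self, lt_self_iff_false, and_false, not_false_eq_true]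
    · rintro ⟨hiT', hiT⟩
      rw [Finset.mem_filter] at hiT' hiT
      have hfi : f i = m := le_antisymm hiT'.2 (not_lt.mp fun hlt => hiT ⟨hiT'.1, hlt⟩)
      rw [← hfi]
      exact (hf i hiT'.1).2
  · -- `J₁ = {j ∈ J | j < m}` covers `T = {i ∈ V | f i < m}`
    rw [hcov]
    refine ⟨fun j hj => ?_, fun i hi => ?_, fun i j hj j' hj' hji hj'i => ?_⟩
    · rw [Finset.mem_filter] at hj
      refine ⟨(h1 j hj.1).1, fun i hji => ?_⟩
      obtain ⟨hiV, hfi⟩ := hsupp j hj.1 i hji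
      exact Finset.mem_filter.mpr ⟨hiV, hfi ▸ hj.2⟩
    · rw [Finset.mem_filter] at hi
      exact ⟨f i, Finset.mem_filter.mpr ⟨(hf i hi.1).1, hi.2⟩, (hf i hi.1).2⟩
    · exact h3 i j (Finset.mem_filter.mp hj).1 j' (Finset.mem_filter.mp hj').1 hji hj'i
  · -- `J₂ = {j ∈ J | m < j}` covers `V \ T'`
    rw [hcov]
    refine ⟨fun j hj => ?_, fun i hi => ?_, fun i j hj j' hj' hji hj'i => ?_⟩
    · rw [Finset.mem_filter] at hj
      refine ⟨(h1 j hj.1).1, fun i hji => ?_⟩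
      obtain ⟨hiV, hfi⟩ := hsupp j hj.1 i hji
      refine Finset.mem_sdiff.mpr ⟨hiV, fun hiT' => ?_⟩
      rw [Finset.mem_filter] at hiT'
      exact absurd hj.2 (not_lt.mpr (hfi ▸ hiT'.2))
    · rw [Finset.mem_sdiff, Finset.mem_filter] at hi
      have hlt : m < f i := not_le.mp fun hle => hi.2 ⟨hi.1, hle⟩
      exact ⟨f i, Finset.mem_filter.mpr ⟨(hf i hi.1).1, hlt⟩, (hf i hi.1).2⟩
    · exact h3 i j (Finset.mem_filter.mp hj).1 j' (Finset.mem_filter.mp hj').1 hji hj'i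
  · -- the sum splits along `J = {j < m} ⊔ {m} ⊔ {m < j}`
    have hsplit : J.filter (fun j => ¬ j < m) = insert m (J.filter fun j => m < j) := by
      ext j
      simp only [Finset.mem_filter, Finset.mem_insert, not_lt]
      constructor
      · rintro ⟨hjJ, hmj⟩
        rcases hmj.lt_or_eq with hlt | heq
        · exact Or.inr ⟨hjJ, hlt⟩
        · exact Or.inl heq.symm
      · rintro (rfl | ⟨hjJ, hlt⟩)
        · exact ⟨hmJ, le_rfl⟩
        · exact ⟨hjJ, hlt.le⟩
    have hnot : m ∉ J.filter (fun j => m < j) := by simp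
    rw [← Finset.sum_filter_add_sum_filter_not J (fun j => j < m), hsplit, Finset.sum_insert hnot]
    abel

/-- GLUING: a cover `J₁` of `T`, an item `m` with support `T' \ T ≠ ∅` and a cover `J₂` of `V \ T'` (`T ⊆ T' ⊆ V`) are
pairwise disjoint and glue to a cover of `V` with point `Σ_{J₁} ε + ε m + Σ_{J₂} ε`. [folklore] -/
theorem exists_glue (ε : Fin N → (Fin 2 →₀ ℕ)) {V T T' : Finset (Fin r)} (hTT' : T ⊆ T') (hT'V : T' ⊆ V)
    (hne : (T' \ T).Nonempty) {m : Fin N} (hm : ∀ i, g m i = 1 ↔ i ∈ T' ∧ i ∉ T) {J₁ J₂ : Finset (Fin N)}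
    (hJ₁ : cov T J₁) (hJ₂ : cov (V \ T') J₂) :
    ∃ J : Finset (Fin N), cov V J ∧ ∑ j ∈ J, ε j = ∑ j ∈ J₁, ε j + ε m + ∑ j ∈ J₂, ε j := by
  classical
  rw [hcov] at hJ₁ hJ₂
  obtain ⟨a1, a2, a3⟩ := hJ₁
  obtain ⟨b1, b2, b3⟩ := hJ₂
  obtain ⟨i₀, hi₀⟩ := hne
  rw [Finset.mem_sdiff] at hi₀
  -- where the supports live
  have hA : ∀ j ∈ J₁, ∀ i, g j i = 1 → i ∈ T := fun j hj i h => (a1 j hj).2 i h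
  have hB : ∀ j ∈ J₂, ∀ i, g j i = 1 → i ∈ V ∧ i ∉ T' := fun j hj i h => Finset.mem_sdiff.mp ((b1 j hj).2 i h)
  -- pairwise disjointness
  have hm1 : m ∉ J₁ := fun h => hi₀.2 (hA m h i₀ ((hm i₀).mpr hi₀))
  have hm2 : m ∉ J₂ := fun h => (hB m h i₀ ((hm i₀).mpr hi₀)).2 hi₀.1
  have hdisj : Disjoint J₁ J₂ := by
    rw [Finset.disjoint_left]
    intro j hj1 hj2
    obtain ⟨i, hi⟩ := (a1 j hj1).1
    exact (hB j hj2 i hi).2 (hTT' (hA j hj1 i hi))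
  have hdisj' : Disjoint J₁ (insert m J₂) := by
    rw [Finset.disjoint_insert_right]
    exact ⟨hm1, hdisj⟩
  refine ⟨J₁ ∪ insert m J₂, ?_, by rw [Finset.sum_union hdisj', Finset.sum_insert hm2, add_assoc]⟩
  rw [hcov]
  refine ⟨fun j hj => ?_, fun i hiV => ?_, fun i j hj j' hj' hji hj'i => ?_⟩
  · -- items: nonempty supports inside `V`
    rw [Finset.mem_union, Finset.mem_insert] at hj
    rcases hj with hj | rfl | hj
    · exact ⟨(a1 j hj).1, fun i hi => hT'V (hTT' (hA j hj i hi))⟩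
    · exact ⟨⟨i₀, (hm i₀).mpr hi₀⟩, fun i hi => hT'V ((hm i).mp hi).1⟩
    · exact ⟨(b1 j hj).1, fun i hi => (hB j hj i hi).1⟩
  · -- every point of `V` is covered
    by_cases hiT : i ∈ T
    · obtain ⟨j, hj, hji⟩ := a2 i hiT
      exact ⟨j, Finset.mem_union_left _ hj, hji⟩
    · by_cases hiT' : i ∈ T'
      · exact ⟨m, Finset.mem_union_right _ (Finset.mem_insert_self _ _), (hm i).mpr ⟨hiT', hiT⟩⟩
      · obtain ⟨j, hj, hji⟩ := b2 i (Finset.mem_sdiff.mpr ⟨hiV, hiT'⟩)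
        exact ⟨j, Finset.mem_union_right _ (Finset.mem_insert_of_mem hj), hji⟩
  · -- at most once: two covering items lie in the same part
    rw [Finset.mem_union, Finset.mem_insert] at hj hj'
    rcases hj with hj | rfl | hj <;> rcases hj' with hj' | hjm | hj'
    · exact a3 i j hj j' hj' hji hj'i
    · subst hjm; exact absurd (hA j hj i hji) ((hm i).mp hj'i).2
    · exact absurd (hTT' (hA j hj i hji)) (hB j' hj' i hj'i).2
    · exact absurd (hA j' hj' i hj'i) ((hm i).mp hji).2
    · exact hjm.symm
    · exact absurd ((hm i).mp hji).1 (hB j' hj' i hj'i).2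
    · exact absurd (hTT' (hA j' hj' i hj'i)) (hB j hj i hji).2
    · subst hjm; exact absurd ((hm i).mp hj'i).1 (hB j hj i hji).2
    · exact b3 i j hj j' hj' hji hj'i

end Cov

/-- **MEDIAN SPLITTING OF AN EXACT-COVER CLOUD (the recursion).**  For the cloud `cl V a` of the covers of `V` (offset
`a`) and `1 ≤ k ≤ |V|`: its chart points number at most the sum, over the data `(T, T')` with `T ⊆ T' ⊆ V`,
`|T| < k ≤ |T'|`, of the chart-point counts of `cl T a` and of the sumset (vectors of the items with support `T' \ T`)
⊕ `cl (V \ T') 0`.  Slices are products (`exists_glue`), every cover lies in the slice of its median datum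
(`exists_split`), and `MedianSplittingAux.chart_ncard_le_sum_data` concludes. [folklore] -/
theorem chart_ncard_le_sum_medianEC (ε : Fin N → (Fin 2 →₀ ℕ))
    (cl : Finset (Fin r) → (Fin 2 →₀ ℕ) → Finset (Fin 2 →₀ ℕ))
    (hcl : ∀ W a, cl W a = ((Finset.univ.filter fun J : Finset (Fin N) =>
        (∀ j ∈ J, (∃ i, g j i = 1) ∧ ∀ i, g j i = 1 → i ∈ W) ∧ (∀ i ∈ W, ∃ j ∈ J, g j i = 1) ∧
          ∀ i, ∀ j ∈ J, ∀ j' ∈ J, g j i = 1 → g j' i = 1 → j = j').image fun J => a + ∑ j ∈ J, ε j))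
    (ch : Finset (Fin 2 →₀ ℕ) → Set (Fin 2 →₀ ℕ))
    (hch : ∀ S, ch S = {p : Fin 2 →₀ ℕ | p ∈ S ∧ ∃ t : ℝ, ∀ q ∈ S, q ≠ p →
        t * ((q 0 : ℕ) : ℝ) + (-1) * ((q 1 : ℕ) : ℝ) < t * ((p 0 : ℕ) : ℝ) + (-1) * ((p 1 : ℕ) : ℝ)})
    (V : Finset (Fin r)) (a : Fin 2 →₀ ℕ) {k : ℕ} (hk : 1 ≤ k) (hkV : k ≤ V.card) :
    (ch (cl V a)).ncard ≤
      ∑ σ ∈ (V.powerset.biUnion fun T' => T'.powerset.image fun T => (T, T')).filter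
          (fun σ : Finset (Fin r) × Finset (Fin r) => σ.1.card < k ∧ k ≤ σ.2.card),
        ((ch (cl σ.1 a)).ncard +
          (ch ((((Finset.univ.filter fun j : Fin N => ∀ i, g j i = 1 ↔ i ∈ σ.2 ∧ i ∉ σ.1).image ε) ×ˢ
              cl (V \ σ.2) 0).image fun pq : (Fin 2 →₀ ℕ) × (Fin 2 →₀ ℕ) => pq.1 + pq.2)).ncard) := by
  classical
  -- the cover predicate, abstracted
  obtain ⟨cov, hcov⟩ : ∃ cov : Finset (Fin r) → Finset (Fin N) → Prop, ∀ W J, cov W J ↔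
      (∀ j ∈ J, (∃ i, g j i = 1) ∧ ∀ i, g j i = 1 → i ∈ W) ∧ (∀ i ∈ W, ∃ j ∈ J, g j i = 1) ∧
        ∀ i, ∀ j ∈ J, ∀ j' ∈ J, g j i = 1 → g j' i = 1 → j = j' := ⟨_, fun _ _ => Iff.rfl⟩
  have hmem : ∀ W a z, z ∈ cl W a ↔ ∃ J, cov W J ∧ a + ∑ j ∈ J, ε j = z := by
    intro W a z
    rw [hcl, Finset.mem_image]
    constructor
    · rintro ⟨J, hJ, hz⟩
      exact ⟨J, (hcov W J).mpr (Finset.mem_filter.mp hJ).2, hz⟩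
    · rintro ⟨J, hJ, hz⟩
      exact ⟨J, Finset.mem_filter.mpr ⟨Finset.mem_univ _, (hcov W J).mp hJ⟩, hz⟩
  simp only [hch]
  refine MedianSplittingAux.chart_ncard_le_sum_data (cl V a) _
    (fun σ : Finset (Fin r) × Finset (Fin r) => cl σ.1 a)
    (fun σ : Finset (Fin r) × Finset (Fin r) =>
      (((Finset.univ.filter fun j : Fin N => ∀ i, g j i = 1 ↔ i ∈ σ.2 ∧ i ∉ σ.1).image ε) ×ˢ
        cl (V \ σ.2) 0).image fun pq : (Fin 2 →₀ ℕ) × (Fin 2 →₀ ℕ) => pq.1 + pq.2)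
    ?_ ?_
  · -- VALIDITY: glued covers are covers
    rintro ⟨T, T'⟩ hσ p hp q hq
    simp only [Finset.mem_filter, Finset.mem_biUnion, Finset.mem_powerset, Finset.mem_image,
      Prod.mk.injEq] at hσ
    obtain ⟨⟨T₂, hT'V, T₁, hTT', hTeq, hT'eq⟩, hTk, hkT'⟩ := hσ
    subst hTeq hT'eq
    obtain ⟨J₁, hJ₁, rfl⟩ := (hmem _ _ _).mp hp
    obtain ⟨pm, hpm, q₂, hq₂, rfl⟩ := SumsetChartCountAux.mem_sumset_iff.mp hq
    obtain ⟨m, hm, rfl⟩ := Finset.mem_image.mp hpm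
    obtain ⟨J₂, hJ₂, rfl⟩ := (hmem _ _ _).mp hq₂
    have hne : (T₂ \ T₁).Nonempty := Finset.card_pos.mp (by rw [Finset.card_sdiff_of_subset hTT']; omega)
    obtain ⟨J, hJ, hsum⟩ := exists_glue g cov hcov ε hTT' hT'V hne (Finset.mem_filter.mp hm).2 hJ₁ hJ₂
    refine (hmem _ _ _).mpr ⟨J, hJ, ?_⟩
    rw [hsum, zero_add]
    abel
  · -- COVERING: every cover lies in the slice of its median datum
    intro z hz
    obtain ⟨J, hJ, rfl⟩ := (hmem _ _ _).mp hz
    obtain ⟨T, T', m, J₁, J₂, hTT', hT'V, hTlt, hkT', hm, hJ₁, hJ₂, hsum⟩ :=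
      exists_split g cov hcov ε hJ hk hkV
    refine ⟨(T, T'), ?_, a + ∑ j ∈ J₁, ε j, (hmem _ _ _).mpr ⟨J₁, hJ₁, rfl⟩,
      ε m + ((0 : Fin 2 →₀ ℕ) + ∑ j ∈ J₂, ε j), ?_, ?_⟩
    · exact Finset.mem_filter.mpr ⟨Finset.mem_biUnion.mpr ⟨T', Finset.mem_powerset.mpr hT'V,
        Finset.mem_image.mpr ⟨T, Finset.mem_powerset.mpr hTT', rfl⟩⟩, hTlt, hkT'⟩
    · exact SumsetChartCountAux.add_mem_sumset
        (Finset.mem_image_of_mem ε (Finset.mem_filter.mpr ⟨Finset.mem_univ _, hm⟩))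
        ((hmem _ _ _).mpr ⟨J₂, hJ₂, rfl⟩)
    · rw [hsum, zero_add]
      abel

end ExactCoverSplittingAux

end Summit.ValiantsHypothesis.ValiantsHypothesis.Theorems.NewtonUnitEquationsNewtonTauWeak
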